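import Summits.HodgeConjecture.HodgeConjecture.Cruxes.BlochSeedDiscOne.SigmaH
import Summits.HodgeConjecture.HodgeConjecture.Cruxes.BlochSeedDiscOne.AxisPhaseTorus
import Summits.HodgeConjecture.HodgeConjecture.Cruxes.BlochSeedDiscOne.PhaseTorusLawN13

/-!
# S⁺ ON THE AXIS ROAD: the door of record HOLDS in the axis room (strengthen g21, v1.0)

`line stmt-HodgeConjecture-18881 Cruxes/BlochSeedDiscOne/Lines/birth.lean 814a6a70c14e831a stub_rung_pad4_seedAt`

HONESTY LABEL. Nothing in this file is a theorem toward HC / HC_CM / HC_AV / №4 / 26512 / 18881 / H2, and it is not a rung of the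
line above. It is a kernel-checked theorem ABOUT THE S⁺ SENTENCE OF RECORD `RuleDPlate.SPlus h sigmaH 0` (v4.1 chain
`OnAlphabet h ∧ Disj ∧ (A1) ∧ RuleD ∧ HallUp ∧ HallPlusUp 8 ∧ μ ≠ 0 ∧ [Σ-H + 28(r − 4) ≤ 3136] ⇒ ⊥`) restricted to the AXIS ROOM
(every support letter an axis letter `c·i^p` or the hub), offered as evidence for the strengthen lens: the S⁺ whose proof is a FINITE
LETTER CALCULUS — the phase-torus law plus a six-block supplier count.

## The theorem

For every height `h` and every two-term design `D` on the height-`h` alphabet: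

  `AxisRoom D ∧ Disj D ∧ D.A1 ∧ RuleD D ∧ D.mu ≠ 0  ⟹  N-mass(D) ≥ 59`, i.e. `copies + rank ≥ 118`      (`nmass_ge_59`),

while the Σ-budget of record forces `copies + rank ≤ 116` (`SigmaH.copies_add_rank_le_of_budget`). Hence

  `sPlusB_axisRoom_budget (h) : SPlusB h (fun D => AxisRoom D ∧ BudgetClause sigmaH 0 D)` —

the door of record is CLOSED on the axis road, at every height, WITHOUT the Hall hypotheses. The same holds in the relaxed room
`AxisRoomHF` (hub-bearing support cells arbitrary) as soon as `E_h(D) = 0`, in particular in every pair-axis relaxed room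
(`sPlus_hf`, `sPlus_pairAxis`).

## The calculus (three finite ingredients)

1. PHASE TORUS, BOTH SIGNS (`AxisPhaseTorus.mu_eq_zero_of_few_posClasses` / `…negClasses` + `PhaseTorus.phaseTorusLawN_thirteen`):
   `μ ≠ 0` forces at least FOURTEEN classes `τ ∈ (ℤ/4)⁴` with `ω(τ) > 0` and fourteen with `ω(τ) < 0`.
2. SUPPLIER CALCULUS (the slide lemma read through RULE D): in the axis room a RULE-D supplier `x` of a hub-free N-cell `y` is a weak
   arrow `x → y`, hence hub-free, of the SAME phase class and of no smaller charge volume (`supplier_inCl`); dually every N-cell supplied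
   to a hub-free P-cell of a negative class is either hub-bearing or of that negative class (`supplied_not_pos`). With `Disj` a supplier
   differs from the supplied cell, and only inside its block.
3. THE SIX-BLOCK COUNT (`three_cover`): six cells, one per block `{g,j} ⊂ {0,1,2,3}`, each differing from a fixed cell exactly inside its
   block, contain THREE pairwise distinct cells (complementary blocks force distinct cells; the mixed case is settled by the slot pattern).
   Consequently (layer cake `exists_exc_pos`): every positive class carries P-mass `≥ 3` above its excess threshold, hence N-mass `≥ 4`
   (`four_le_massN_of_posCl`); and one negative class supplies `≥ 3` N-cells outside the positive classes (`three_le_massN_nonpos`).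
   Total: `N-mass ≥ 14·4 + 3 = 59`, against the budget's `2·N-mass = copies + rank ≤ 116`.

## Tightness of the hypotheses (kernel inhabitants of this session, separate files)

* RULE D cannot be dropped: `AxisRoomInhabitant24` (`D⋆(24)`: axis, Disj, A1, HallUp, HallPlusUp 8, `μ = 32`, budget MET, ¬RuleD).
* The BUDGET cannot be dropped: `AxisRuleDInhabitant` (`R⋆`: axis, Disj, A1, RuleD, HallUp, HallPlusUp 8, `μ = 32`, copies 9908).
So on the axis road the Σ-budget is NECESSARY AND SUFFICIENT for the door of record; the margin of the count is `118 > 116`.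

What this does NOT say: nothing about designs with an off-axis support letter (there `E_h ≠ 0` in general and the class measure does not
control `μ`); the door of record `SPlus 14 sigmaH 0` itself stays open off the axis road.
-/

set_option linter.dupNamespace false

namespace Summit.HodgeConjecture.HodgeConjecture.Cruxes.BlochSeedDiscOne.AxisSPlus

open Summit.HodgeConjecture.HodgeConjecture.Cruxes.BlochSeedDiscOne.DepthBoundA4
open Summit.HodgeConjecture.HodgeConjecture.Cruxes.BlochSeedDiscOne.LeggedFloor (NullStep Supplies Detects RuleDP RuleD Disj)
open Summit.HodgeConjecture.HodgeConjecture.Cruxes.BlochSeedDiscOne.DeepLayerLaws (massOn colevel_eq_of_onAlphabet colevel_nonneg)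
open Summit.HodgeConjecture.HodgeConjecture.Cruxes.BlochSeedDiscOne.HallB136 (HallUp)
open Summit.HodgeConjecture.HodgeConjecture.Cruxes.BlochSeedDiscOne.RuleDPlate (HallPlusUp BudgetClause SPlusB SPlus)
open Summit.HodgeConjecture.HodgeConjecture.Cruxes.BlochSeedDiscOne.SigmaH (sigmaH copies_add_rank_le_of_budget)
open Summit.HodgeConjecture.HodgeConjecture.Cruxes.BlochSeedDiscOne.RingTwoMassLaw.ClassLaw (E dep)
open Summit.HodgeConjecture.HodgeConjecture.Cruxes.BlochSeedDiscOne.AxisPhaseTorus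
open Summit.HodgeConjecture.HodgeConjecture.Cruxes.BlochSeedDiscOne.PhaseTorus (PT PhaseTorusLawN phaseTorusLawN_thirteen)

/-! ## §1 Mass bookkeeping on one side of a design -/

theorem massOn_mono (L : List (Cell × ℕ)) {U W : Cell → Prop} [DecidablePred U] [DecidablePred W] (h : ∀ c, U c → W c) :
    massOn L U ≤ massOn L W := by
  induction L with
  | nil => simp [massOn]
  | cons a l ih =>
    rw [massOn_cons, massOn_cons]
    by_cases hU : U a.1
    · rw [if_pos hU, if_pos (h _ hU)]; omega
    · rw [if_neg hU]; split_ifs <;> omega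

theorem massOn_congr (L : List (Cell × ℕ)) {U W : Cell → Prop} [DecidablePred U] [DecidablePred W] (h : ∀ c, U c ↔ W c) :
    massOn L U = massOn L W :=
  le_antisymm (massOn_mono L fun c hc => (h c).mp hc) (massOn_mono L fun c hc => (h c).mpr hc)

/-- splitting a mass along a second predicate. -/
theorem massOn_split (L : List (Cell × ℕ)) (U W : Cell → Prop) [DecidablePred U] [DecidablePred W] :
    massOn L U = massOn L (fun c => U c ∧ W c) + massOn L (fun c => U c ∧ ¬ W c) := by
  induction L with
  | nil => simp [massOn]
  | cons a l ih =>
    rw [massOn_cons, massOn_cons, massOn_cons, ih]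
    by_cases hU : U a.1
    · by_cases hW : W a.1
      · rw [if_pos hU, if_pos ⟨hU, hW⟩, if_neg (fun h => h.2 hW)]; omega
      · rw [if_pos hU, if_neg (fun h => hW h.2), if_pos ⟨hU, hW⟩]; omega
    · rw [if_neg hU, if_neg (fun h => hU h.1), if_neg (fun h => hU h.1)]; omega

/-- the mass of a predicate and of its negation add up to the total mass of the side. -/
theorem massOn_add_massOn_not (L : List (Cell × ℕ)) (U : Cell → Prop) [DecidablePred U] :
    massOn L U + massOn L (fun c => ¬ U c) = (L.map Prod.snd).sum := by
  induction L with
  | nil => simp [massOn]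
  | cons a l ih =>
    rw [massOn_cons, massOn_cons, List.map_cons, List.sum_cons, ← ih]
    by_cases hU : U a.1
    · rw [if_pos hU, if_neg (not_not.mpr hU)]; omega
    · rw [if_neg hU, if_pos hU]; omega

theorem le_massOn_of_mem (L : List (Cell × ℕ)) (U : Cell → Prop) [DecidablePred U] {c : Cell} {m : ℕ} (hcm : (c, m) ∈ L)
    (hU : U c) : m ≤ massOn L U := by
  unfold massOn
  exact List.le_sum_of_mem (List.mem_map.mpr ⟨(c, m), List.mem_filter.mpr ⟨hcm, by simpa using hU⟩, rfl⟩)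

/-- a positive mass is witnessed by a supported cell. -/
theorem exists_of_massOn_pos (L : List (Cell × ℕ)) (U : Cell → Prop) [DecidablePred U] (h : 0 < massOn L U) :
    ∃ c m, (c, m) ∈ L ∧ 0 < m ∧ U c := by
  induction L with
  | nil => simp [massOn] at h
  | cons a l ih =>
    rw [massOn_cons] at h
    by_cases hU : U a.1
    · rw [if_pos hU] at h
      by_cases ha : 0 < a.2
      · exact ⟨a.1, a.2, List.mem_cons.mpr (Or.inl rfl), ha, hU⟩
      · obtain ⟨c, m, hm, hpos, hc⟩ := ih (by omega)
        exact ⟨c, m, List.mem_cons.mpr (Or.inr hm), hpos, hc⟩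
    · rw [if_neg hU] at h
      obtain ⟨c, m, hm, hpos, hc⟩ := ih (by omega)
      exact ⟨c, m, List.mem_cons.mpr (Or.inr hm), hpos, hc⟩

/-- three pairwise distinct supported cells inside a predicate give mass `≥ 3`. -/
theorem three_le_massOn (L : List (Cell × ℕ)) (U : Cell → Prop) [DecidablePred U] {c₁ c₂ c₃ : Cell}
    (h₁ : U c₁ ∧ ∃ m, (c₁, m) ∈ L ∧ 0 < m) (h₂ : U c₂ ∧ ∃ m, (c₂, m) ∈ L ∧ 0 < m) (h₃ : U c₃ ∧ ∃ m, (c₃, m) ∈ L ∧ 0 < m)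
    (h12 : c₁ ≠ c₂) (h13 : c₁ ≠ c₃) (h23 : c₂ ≠ c₃) : 3 ≤ massOn L U := by
  obtain ⟨hU₁, m₁, hm₁, hp₁⟩ := h₁
  obtain ⟨hU₂, m₂, hm₂, hp₂⟩ := h₂
  obtain ⟨hU₃, m₃, hm₃, hp₃⟩ := h₃
  have e₁ := massOn_split L U (fun c => c = c₁)
  have e₂ := massOn_split L (fun c => U c ∧ ¬ c = c₁) (fun c => c = c₂)
  have a₁ : m₁ ≤ massOn L (fun c => U c ∧ c = c₁) := le_massOn_of_mem L _ hm₁ ⟨hU₁, rfl⟩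
  have a₂ : m₂ ≤ massOn L (fun c => (U c ∧ ¬ c = c₁) ∧ c = c₂) :=
    le_massOn_of_mem L _ hm₂ ⟨⟨hU₂, fun e => h12 e.symm⟩, rfl⟩
  have a₃ : m₃ ≤ massOn L (fun c => (U c ∧ ¬ c = c₁) ∧ ¬ c = c₂) :=
    le_massOn_of_mem L _ hm₃ ⟨⟨hU₃, fun e => h13 e.symm⟩, fun e => h23 e.symm⟩
  omega

/-! ## §2 The supplier calculus in the (relaxed) axis room -/

/-- a RULE-D supplier pair is a weak arrow. -/
theorem weakLive_of_supplies {x y : Cell} {g j : Fin 4} (hS : Supplies x y g j) : WeakLive x y := by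
  intro f
  by_cases hfg : f = g
  · subst hfg
    rcases hS.2.1 with e | ns
    · exact Or.inl e
    · exact Or.inr ⟨ns.1, le_of_eq ns.2⟩
  by_cases hfj : f = j
  · subst hfj
    rcases hS.2.2 with e | ns
    · exact Or.inl e
    · exact Or.inr ⟨ns.1, le_of_eq ns.2⟩
  exact Or.inl (hS.1 f hfg hfj)

/-- a hub-free cell detects every block. -/
theorem detects_of_hubFree {c : Cell} (hc : HubFree c) (g j : Fin 4) : Detects c g j := by
  rintro ⟨hx, hy, -, -, -⟩
  have h0 := hc g
  unfold Letter.colevel at h0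
  rw [hx, hy] at h0
  simp at h0

/-- **supplier calculus, N-side**: in the relaxed axis room a RULE-D supplier of a hub-free N-cell of class `τ` and volume `≥ s` is a
hub-free P-cell of class `τ` and volume `≥ s` (slide lemma). -/
theorem supplier_inCl {h : ℤ} {D : Design} (hD : D.OnAlphabet h) (hR : AxisRoomHF D) {x y : Cell} (hx : x ∈ D.suppP)
    (hy : y ∈ D.suppN) {g j : Fin 4} (hS : Supplies x y g j) {τ : PT} {s : ℤ} (hyI : InCl τ s y) : InCl τ s x := by
  obtain ⟨hyf, hyτ, hys⟩ := hyI
  have hw := weakLive_of_supplies hS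
  have hxf := hubFree_of_weakLive (onAlphabet_of_memP hD hx) (onAlphabet_of_memN hD hy) hyf hw
  obtain ⟨hph, hle⟩ := slide_cell (onAlphabet_of_memP hD hx) (onAlphabet_of_memN hD hy)
    (hR x (List.mem_append_right _ hx) hxf) (hR y (List.mem_append_left _ hy) hyf) hyf hw
  exact ⟨hxf, hph.trans hyτ, le_trans hys (V_le_of_slide hle)⟩

/-- **supplier calculus, P-side**: an N-cell supplied (RULE D) to a hub-free P-cell of a class of negative measure is NOT a hub-free
cell of a positive class (it is hub-bearing, or hub-free of that negative class). -/
theorem supplied_not_pos {h : ℤ} {D : Design} (hD : D.OnAlphabet h) (hR : AxisRoomHF D) {x y : Cell} (hx : x ∈ D.suppP)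
    (hy : y ∈ D.suppN) {g j : Fin 4} (hS : Supplies x y g j) (hxf : HubFree x) (hxσ : omegaC D (cphase x) < 0) :
    ¬ (HubFree y ∧ cphase y ∈ posCl D) := by
  rintro ⟨hyf, hyp⟩
  have hw := weakLive_of_supplies hS
  obtain ⟨hph, -⟩ := slide_cell (onAlphabet_of_memP hD hx) (onAlphabet_of_memN hD hy)
    (hR x (List.mem_append_right _ hx) hxf) (hR y (List.mem_append_left _ hy) hyf) hyf hw
  rw [← hph] at hyp
  exact absurd (mem_posCl.mp hyp) (not_lt.mpr hxσ.le)

/-! ## §3 The six-block count: three pairwise distinct suppliers -/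

/-- **THE SIX-BLOCK COUNT.** If every block `{g,j}` has a cell in `M` differing from `y` but agreeing with `y` off the block, then `M`
contains three pairwise distinct cells. -/
theorem three_cover {y : Cell} {M : Cell → Prop}
    (hsup : ∀ g j : Fin 4, g < j → ∃ x, M x ∧ x ≠ y ∧ ∀ f : Fin 4, f ≠ g → f ≠ j → x f = y f) :
    ∃ x₁ x₂ x₃, M x₁ ∧ M x₂ ∧ M x₃ ∧ x₁ ≠ x₂ ∧ x₁ ≠ x₃ ∧ x₂ ≠ x₃ := by
  obtain ⟨A, hA, hAy, hAo⟩ := hsup 0 1 (by decide)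
  obtain ⟨B, hB, hBy, hBo⟩ := hsup 2 3 (by decide)
  obtain ⟨C, hC, hCy, hCo⟩ := hsup 0 2 (by decide)
  obtain ⟨D, hD, hDy, hDo⟩ := hsup 1 3 (by decide)
  obtain ⟨E, hE, hEy, hEo⟩ := hsup 0 3 (by decide)
  obtain ⟨F, hF, hFy, hFo⟩ := hsup 1 2 (by decide)
  -- suppliers of complementary blocks are distinct: a common value would agree with `y` everywhere
  have hAB : A ≠ B := by
    intro e; apply hAy; funext f
    by_cases h0 : f = 0
    · subst h0; have t := hBo 0 (by decide) (by decide); rwa [← e] at t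
    by_cases h1 : f = 1
    · subst h1; have t := hBo 1 (by decide) (by decide); rwa [← e] at t
    exact hAo f h0 h1
  have hCD : C ≠ D := by
    intro e; apply hCy; funext f
    by_cases h0 : f = 0
    · subst h0; have t := hDo 0 (by decide) (by decide); rwa [← e] at t
    by_cases h2 : f = 2
    · subst h2; have t := hDo 2 (by decide) (by decide); rwa [← e] at t
    exact hCo f h0 h2
  by_cases hCA : C = A
  · by_cases hDB : D = B
    · -- `A = C` differs from `y` only in slot `0`, `B = D` only in slot `3`; `F` agrees with `y` in slots `0` and `3`
      refine ⟨A, B, F, hA, hB, hF, hAB, ?_, ?_⟩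
      · intro e; apply hAy; funext f
        by_cases h0 : f = 0
        · subst h0; have t := hFo 0 (by decide) (by decide); rwa [← e] at t
        by_cases h1 : f = 1
        · subst h1; have t := hCo 1 (by decide) (by decide); rwa [hCA] at t
        exact hAo f h0 h1
      · intro e; apply hBy; funext f
        by_cases h3 : f = 3
        · subst h3; have t := hFo 3 (by decide) (by decide); rwa [← e] at t
        by_cases h2 : f = 2
        · subst h2; have t := hDo 2 (by decide) (by decide); rwa [hDB] at t
        exact hBo f h2 h3
    · exact ⟨A, B, D, hA, hB, hD, hAB, fun e => hCD (hCA.trans e), fun e => hDB e.symm⟩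
  · by_cases hCB : C = B
    · by_cases hDA : D = A
      · -- `B = C` differs from `y` only in slot `2`, `A = D` only in slot `1`; `E` agrees with `y` in slots `1` and `2`
        refine ⟨A, B, E, hA, hB, hE, hAB, ?_, ?_⟩
        · intro e; apply hAy; funext f
          by_cases h1 : f = 1
          · subst h1; have t := hEo 1 (by decide) (by decide); rwa [← e] at t
          by_cases h0 : f = 0
          · subst h0; have t := hDo 0 (by decide) (by decide); rwa [hDA] at t
          exact hAo f h0 h1
        · intro e; apply hBy; funext f
          by_cases h2 : f = 2
          · subst h2; have t := hEo 2 (by decide) (by decide); rwa [← e] at t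
          by_cases h3 : f = 3
          · subst h3; have t := hCo 3 (by decide) (by decide); rwa [hCB] at t
          exact hBo f h2 h3
      · exact ⟨A, B, D, hA, hB, hD, hAB, fun e => hDA e.symm, fun e => hCD (hCB.trans e)⟩
    · exact ⟨A, B, C, hA, hB, hC, hAB, fun e => hCA e.symm, fun e => hCB e.symm⟩

/-! ## §4 Positive classes cost N-mass four; a negative class costs three more -/

/-- **every positive class carries N-mass `≥ 4`** (relaxed axis room, `Disj`, RULE D). -/
theorem four_le_massN_of_posCl {h : ℤ} {D : Design} (hD : D.OnAlphabet h) (hR : AxisRoomHF D) (hdis : Disj D) (hrd : RuleD D)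
    {τ : PT} (hτ : 0 < omegaC D τ) : 4 ≤ massOn D.N (InCl τ 0) := by
  obtain ⟨s, hs⟩ := exists_exc_pos hτ
  unfold exc at hs
  have hNpos : 0 < massOn D.N (InCl τ s) := by omega
  obtain ⟨y, m, hm, hmpos, hyI⟩ := exists_of_massOn_pos D.N _ hNpos
  have hy : y ∈ D.suppN := (mem_suppN_iff D y).mpr ⟨m, hm, hmpos⟩
  have hsup : ∀ g j : Fin 4, g < j → ∃ x, (InCl τ s x ∧ ∃ m, (x, m) ∈ D.P ∧ 0 < m) ∧ x ≠ y ∧ ∀ f : Fin 4, f ≠ g → f ≠ j → x f = y f := by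
    intro g j hgj
    obtain ⟨x, hx, hS⟩ := hrd.1 y hy g j hgj (detects_of_hubFree hyI.1 g j)
    exact ⟨x, ⟨supplier_inCl hD hR hx hy hS hyI, (mem_suppP_iff D x).mp hx⟩, fun e => hdis y hy (e ▸ hx), hS.1⟩
  obtain ⟨x₁, x₂, x₃, h₁, h₂, h₃, h12, h13, h23⟩ := three_cover hsup
  have h3 : 3 ≤ massOn D.P (InCl τ s) := three_le_massOn D.P (InCl τ s) h₁ h₂ h₃ h12 h13 h23
  have hmono : massOn D.N (InCl τ s) ≤ massOn D.N (InCl τ 0) :=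
    massOn_mono D.N fun c hc => ⟨hc.1, hc.2.1, V_nonneg c⟩
  omega

/-- the POSITIVE CELLS (hub-free cells of a positive class) are the class union of `{ω > 0}` with thresholds `0`. -/
theorem posCell_iff_inClass (D : Design) (c : Cell) :
    (HubFree c ∧ cphase c ∈ posCl D) ↔ InClass (posCl D) (fun _ => 0) c :=
  ⟨fun hc => ⟨hc.1, hc.2, V_nonneg c⟩, fun hc => ⟨hc.1, hc.2.1⟩⟩

/-- **the positive classes together carry N-mass `≥ 4·#{ω > 0}`.** -/
theorem massN_posCell_ge {h : ℤ} {D : Design} (hD : D.OnAlphabet h) (hR : AxisRoomHF D) (hdis : Disj D) (hrd : RuleD D) :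
    4 * (posCl D).card ≤ massOn D.N (fun c => HubFree c ∧ cphase c ∈ posCl D) := by
  rw [massOn_congr D.N (posCell_iff_inClass D), massOn_inClass_eq_sum]
  have hcl : ∀ τ ∈ posCl D, 4 ≤ massOn D.N (InCl τ ((fun _ : PT => (0 : ℤ)) τ)) :=
    fun τ hτ => four_le_massN_of_posCl hD hR hdis hrd (mem_posCl.mp hτ)
  calc 4 * (posCl D).card = ∑ τ ∈ posCl D, 4 := by rw [Finset.sum_const, smul_eq_mul, mul_comm]
    _ ≤ ∑ τ ∈ posCl D, massOn D.N (InCl τ ((fun _ : PT => (0 : ℤ)) τ)) := Finset.sum_le_sum hcl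

/-- **a negative class supplies three N-cells outside the positive cells** (RULE D, P-side). -/
theorem three_le_massN_not_posCell {h : ℤ} {D : Design} (hD : D.OnAlphabet h) (hR : AxisRoomHF D) (hdis : Disj D)
    (hrd : RuleD D) {σ : PT} (hσ : omegaC D σ < 0) : 3 ≤ massOn D.N (fun c => ¬ (HubFree c ∧ cphase c ∈ posCl D)) := by
  obtain ⟨s, hs⟩ : ∃ s, exc D σ s < 0 := by
    have h0 := hσ
    rw [omegaC_eq_sum_exc] at h0
    have h0' : ∑ s ∈ Finset.Icc 1 (Tbig D), exc D σ s < ∑ s ∈ Finset.Icc 1 (Tbig D), (0 : ℤ) := by simpa using h0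
    obtain ⟨s, -, hs⟩ := Finset.exists_lt_of_sum_lt h0'
    exact ⟨s, hs⟩
  unfold exc at hs
  have hPpos : 0 < massOn D.P (InCl σ s) := by omega
  obtain ⟨x, m, hm, hmpos, hxI⟩ := exists_of_massOn_pos D.P _ hPpos
  have hx : x ∈ D.suppP := (mem_suppP_iff D x).mpr ⟨m, hm, hmpos⟩
  have hxσ : omegaC D (cphase x) < 0 := by rw [hxI.2.1]; exact hσ
  have hsup : ∀ g j : Fin 4, g < j → ∃ y, (¬ (HubFree y ∧ cphase y ∈ posCl D) ∧ ∃ m, (y, m) ∈ D.N ∧ 0 < m) ∧ y ≠ x ∧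
      ∀ f : Fin 4, f ≠ g → f ≠ j → y f = x f := by
    intro g j hgj
    obtain ⟨y, hy, hS⟩ := hrd.2 x hx g j hgj (detects_of_hubFree hxI.1 g j)
    exact ⟨y, ⟨supplied_not_pos hD hR hx hy hS hxI.1 hxσ, (mem_suppN_iff D y).mp hy⟩, fun e => hdis y hy (e ▸ hx),
      fun f hf hf' => (hS.1 f hf hf').symm⟩
  obtain ⟨y₁, y₂, y₃, h₁, h₂, h₃, h12, h13, h23⟩ := three_cover hsup
  exact three_le_massOn D.N (fun c => ¬ (HubFree c ∧ cphase c ∈ posCl D)) h₁ h₂ h₃ h12 h13 h23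

/-! ## §5 The N-mass law and S⁺ on the axis road -/

/-- **THE N-MASS LAW (relaxed axis room, `E = 0`)**: `Disj ∧ (A1) ∧ RuleD ∧ μ ≠ 0 ⟹ N-mass ≥ 59`. -/
theorem nmass_ge_59_hf {h : ℤ} {D : Design} (hD : D.OnAlphabet h) (hR : AxisRoomHF D) (hE : E h D = 0) (hdis : Disj D)
    (h1 : D.A1) (hrd : RuleD D) (hμ : D.mu ≠ 0) : 59 ≤ (D.N.map Prod.snd).sum := by
  have hpos : 14 ≤ (posCl D).card := by
    by_contra hlt
    exact hμ (mu_eq_zero_of_few_posClasses hD hR hE h1 phaseTorusLawN_thirteen (posCl D) (by omega) not_mem_posCl)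
  have hneg : 14 ≤ (negCl D).card := by
    by_contra hlt
    exact hμ (mu_eq_zero_of_few_negClasses hD hR hE h1 phaseTorusLawN_thirteen (negCl D) (by omega) not_mem_negCl)
  obtain ⟨σ, hσ⟩ := Finset.card_pos.mp (show 0 < (negCl D).card by omega)
  have hA := massN_posCell_ge hD hR hdis hrd
  have hB := three_le_massN_not_posCell hD hR hdis hrd (mem_negCl.mp hσ)
  have hsplit := massOn_add_massOn_not D.N (fun c => HubFree c ∧ cphase c ∈ posCl D)
  omega

/-- **THE N-MASS LAW IN THE AXIS ROOM** (every height): `AxisRoom ∧ Disj ∧ (A1) ∧ RuleD ∧ μ ≠ 0 ⟹ N-mass ≥ 59`. -/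
theorem nmass_ge_59 {h : ℤ} {D : Design} (hD : D.OnAlphabet h) (hR : AxisRoom D) (hdis : Disj D) (h1 : D.A1) (hrd : RuleD D)
    (hμ : D.mu ≠ 0) : 59 ≤ (D.N.map Prod.snd).sum :=
  nmass_ge_59_hf hD (axisRoomHF_of_axisRoom hR) (E_eq_zero_of_axisRoom hD h1 hR) hdis h1 hrd hμ

theorem copies_add_rank_eq (D : Design) : (D.copies : ℤ) + D.rank = 2 * ((D.N.map Prod.snd).sum : ℤ) := by
  unfold Design.copies Design.rank; push_cast; ring

/-- **`copies + rank ≥ 118`** in the axis room under the door hypotheses `Disj ∧ (A1) ∧ RuleD ∧ μ ≠ 0` (no Hall, no budget). -/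
theorem copies_add_rank_ge_118 {h : ℤ} {D : Design} (hD : D.OnAlphabet h) (hR : AxisRoom D) (hdis : Disj D) (h1 : D.A1)
    (hrd : RuleD D) (hμ : D.mu ≠ 0) : 118 ≤ (D.copies : ℤ) + D.rank := by
  have h59 := nmass_ge_59 hD hR hdis h1 hrd hμ
  rw [copies_add_rank_eq]; omega

/-- the Σ-budget of record caps the N-mass at `58`. -/
theorem nmass_le_58_of_budget (D : Design) (hb : BudgetClause sigmaH 0 D) : (D.N.map Prod.snd).sum ≤ 58 := by
  have h₁ := copies_add_rank_le_of_budget D hb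
  have h₂ := copies_add_rank_eq D
  omega

/-- **S⁺ ON THE AXIS ROAD, relaxed room**: hub-free support cells axis, `E_h(D) = 0`, `Disj`, (A1), RULE D, `μ ≠ 0` and the Σ-budget of
record are CONTRADICTORY — at every height, with NO Hall hypothesis. -/
theorem sPlus_hf (h : ℤ) {D : Design} (hD : D.OnAlphabet h) (hR : AxisRoomHF D) (hE : E h D = 0) (hdis : Disj D) (h1 : D.A1)
    (hrd : RuleD D) (hμ : D.mu ≠ 0) (hb : BudgetClause sigmaH 0 D) : False := by
  have h59 := nmass_ge_59_hf hD hR hE hdis h1 hrd hμ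
  have h58 := nmass_le_58_of_budget D hb
  omega

/-- **S⁺ ON THE AXIS ROAD**: in the axis room `Disj ∧ (A1) ∧ RuleD ∧ μ ≠ 0 ∧ [Σ-H + 28(r − 4) ≤ 3136]` is contradictory, every height. -/
theorem sPlus_axisRoom (h : ℤ) {D : Design} (hD : D.OnAlphabet h) (hR : AxisRoom D) (hdis : Disj D) (h1 : D.A1) (hrd : RuleD D)
    (hμ : D.mu ≠ 0) (hb : BudgetClause sigmaH 0 D) : False :=
  sPlus_hf h hD (axisRoomHF_of_axisRoom hR) (E_eq_zero_of_axisRoom hD h1 hR) hdis h1 hrd hμ hb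

/-- **S⁺ in every pair-axis relaxed room**: hub-free support cells axis and ONE slot pair never doubly off-axis on the support. -/
theorem sPlus_pairAxis (h : ℤ) {D : Design} (hD : D.OnAlphabet h) (hR : AxisRoomHF D) {g g' : Fin 4} (hne : g ≠ g')
    (hpr : PairAxisRoom g g' D) (hdis : Disj D) (h1 : D.A1) (hrd : RuleD D) (hμ : D.mu ≠ 0) (hb : BudgetClause sigmaH 0 D) :
    False :=
  sPlus_hf h hD hR (E_eq_zero_of_pairAxisRoom hD h1 hne hpr) hdis h1 hrd hμ hb

/-- **THE DOOR OF RECORD HOLDS ON THE AXIS ROAD**: the v4.1 sentence `SPlusB h` with the budget of record AND the axis room as its budget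
predicate is a theorem, at every height `h` (the Hall hypotheses of the sentence are not even used). -/
theorem sPlusB_axisRoom_budget (h : ℤ) : SPlusB h (fun D => AxisRoom D ∧ BudgetClause sigmaH 0 D) :=
  fun _ hD hdis h1 hrd _ _ hμ hb => sPlus_axisRoom h hD hb.1 hdis h1 hrd hμ hb.2

/-- the same in the relaxed pair-axis rooms. -/
theorem sPlusB_pairAxis_budget (h : ℤ) {g g' : Fin 4} (hne : g ≠ g') :
    SPlusB h (fun D => AxisRoomHF D ∧ PairAxisRoom g g' D ∧ BudgetClause sigmaH 0 D) :=
  fun _ hD hdis h1 hrd _ _ hμ hb => sPlus_pairAxis h hD hb.1 hne hb.2.1 hdis h1 hrd hμ hb.2.2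

/-- **reading for the statement of record** `SPlus h sigmaH 0 = SPlusB h (BudgetClause sigmaH 0)`: every counterexample to it (if any)
has a support cell with an OFF-AXIS letter; equivalently `SPlus h sigmaH 0` is equivalent to its restriction to non-axis designs. -/
theorem sPlus_iff_offAxis (h : ℤ) : SPlus h sigmaH 0 ↔
    ∀ D : Design, D.OnAlphabet h → ¬ AxisRoom D → Disj D → D.A1 → RuleD D → HallUp D → HallPlusUp D 8 → D.mu ≠ 0 →
      BudgetClause sigmaH 0 D → False :=
  ⟨fun H D hD _ hdis h1 hrd hu hp hμ hb => H D hD hdis h1 hrd hu hp hμ hb,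
   fun H D hD hdis h1 hrd hu hp hμ hb => by
    by_cases hax : AxisRoom D
    · exact sPlus_axisRoom h hD hax hdis h1 hrd hμ hb
    · exact H D hD hax hdis h1 hrd hu hp hμ hb⟩

end Summit.HodgeConjecture.HodgeConjecture.Cruxes.BlochSeedDiscOne.AxisSPlus
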